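import Literature.NumberTheory.EllipticCurves.Hida2010MuInvariant.AnticyclotomicKatzMuInvariant
import Literature.NumberTheory.EllipticCurves.SigmaEulerData
import HarnessLib

/-!
# Castella–Grossi–Lee–Skinner 2022, the PROOF of Thm. 2.2.1 (`thm:kriz`) from its displayed input (eq:cong-mf):
# the Eisenstein congruence `𝓛_E ≡ (𝓔^ι_{φ,ψ})²·(𝓛_φ)² (mod pΛ^{ur})` GIVEN full Eisenstein descent of `f_E`
# of a type `(φ̃, φ̃⁻¹, N₊, N₋, N₀)` (Kriz 2016 Def. 31 / Rem. 32) — ONE named fact (`def … : Prop`), statement only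

F. Castella, G. Grossi, J. Lee, C. Skinner, *On the anticyclotomic Iwasawa theory of rational elliptic curves at Eisenstein
primes*, Invent. Math. **227** (2022) 517–580, §2.2, Thm. 2.2.1 and its proof (arXiv:2008.02571v2 TeX L1051–L1116); D. Kriz,
*Generalized Heegner cycles at Eisenstein primes and the Katz p-adic L-function*, Algebra Number Theory **10** (2016) 309–374,
Def. 31, Rem. 32, Rem. 33 (arXiv:1512.05032 pp. 20–21).

Cell `bsd-eis` (run/shared/lean/pub/bsd-eis/), width seat `bsd-line-x1-p1-w2` gen 26, for crux 2 `GoodLatticeBDPValue`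
(stmt-BirchSwinnertonDyer-19032), line `halves`, content stub 3a-A — the PRODUCER side of director-bsd key (β) «PUB typing of
CGLS Thm. 2.2.1». Its CONSUMER is already kernel-checked: `Summit.…Theorems.GoodLatticeAnacongOfEisensteinCongruence.
anacong_conclusion_of_eisensteinCongruence` (p757455) turns exactly this conclusion shape, together with Hida 2010 Thm. I
(`Hida2010MuInvariant.thmI_mu_katzLFunction_eq_zero`), into the conclusion of 3a-A; the assembly
`Summit.…Theorems.GoodLatticeAnacongOfCGLSProofThm221.anacong_of_proofThm221_of_thmI` (this seat, proposed after this file) does so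
BY NAME at the call shape of the tree's consumers of [AN].

WHY A PROOF-STEP FACT AND NOT THM. 2.2.1 ITSELF. The journal statement of Thm. 2.2.1 carries «`φ ≠ 𝟙`», used at exactly one
line of its proof — "By [Kriz], our hypothesis on `E[p]` implies that there is a congruence `f ≡ G (mod p)` (2.12)" (cell
`Cruxes/GoodLatticeBDPValue/Lines/halves_3aA_pagecheck_leadg6.md` §4) — while the good-lattice anomalous case of crux 2 needs
`φ = 𝟙` at `p = 3`. Everything AFTER (2.12) is printed for every `φ`: `𝓛_G ≡ 𝓔^ι_{φ,ψ}·𝓛_φ` (2.14) from Kriz's evaluation of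
`𝓛_G` and the interpolation property of `𝓛_φ`, `𝓛_E ≡ (𝓛_G)² (mod pΛ^{ur})` (2.15) from `θ^m f(x_𝔞) ≡ θ^m G(x_𝔞)`, "the
combination of (2.14) and (2.15) now yields the theorem". So the fact below states what the proof proves: (2.12) ⟹ the
congruence, and (2.12) — `f ≡ E₂^{φ,φ⁻¹,(N)} (mod p)` for the type `(N₊, N₋, N₀)` — is entered through its DEFINITION, Kriz's
Def. 31 (full Eisenstein descent of type `(ψ₁, ψ₂, N₊, N₋, N₀)`; Rem. 32: "When `f` has full Eisenstein descent, this
congruence holds for `j ≥ 0`"). The EXISTENCE of such a type for a reducible `E[p]` (Kriz Thm. 34 (3)/35, and Def. 31 (5) under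
the full-descent datum) is NOT part of this fact; it is kernel work of the consumer's cell.

TRANSCRIPTION TABLE, FAITHFULNESS («weaker than print») and the frame dictionary: see the declaration docstring. Named fact
(D-0014/D-0026 accounting: +1, consumer named above): a `Prop`, nothing asserted; no `sorry`, no instance, no notation; NEVER cite
it as a theorem. No summit statement, no case of BSD, no theorem of CGLS / Kriz / Hida / Keller–Yin is proved by this file.
-/

noncomputable section

open scoped Classical

open WeierstrassCurve NumberField IsDedekindDomain Field PowerSeries
  Literature.NumberTheory.EllipticCurves Literature.NumberTheory.EllipticCurves.Rank1Residual
  Literature.NumberTheory.EllipticCurves.ModularForms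
  Literature.NumberTheory.GaloisRepresentations Literature.NumberTheory.QuadraticFields
  Literature.NumberTheory.EllipticCurves.KellerYin2024

namespace Literature.NumberTheory.EllipticCurves.CastellaGrossiLeeSkinner2022

/-- **Castella–Grossi–Lee–Skinner, Invent. Math. 227 (2022), PROOF of Thm. 2.2.1 (`thm:kriz`; arXiv:2008.02571v2 TeX
L1062–L1116) from its displayed input (eq:cong-mf) — the Eisenstein congruence `𝓛_E ≡ (𝓔^ι_{φ,ψ})²·(𝓛_φ)² (mod pΛ^{ur})` GIVEN
that `f_E` has FULL Eisenstein descent of the type `(φ̃, φ̃⁻¹, N₊, N₋, N₀)` (Kriz 2016 Def. 31; Rem. 32: full descent ⟹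
`f ≡ E₂^{φ,φ⁻¹,(N)} (mod p)` = (eq:cong-mf)) — NAMED FACT, research-grade PUBLISHED proof step (same species as
`proofThm422_exists_isBDPLFunction_isTorsion_charIdeal_dvd`).**
PRINT. Thm. 2.2.1: "Assume that `E[p]^{ss} ≅ 𝔽_p(φ) ⊕ 𝔽_p(ψ)` as `G_ℚ`-modules, with the characters labeled so that `p ∤ cond(φ)`
[v2/journal: and suppose `φ ≠ 𝟙`]. Then there is a factorization `N/N₀ = N₊N₋` with `a_ℓ ≡ φ(ℓ)` if `ℓ ∣ N₊`, `a_ℓ ≡ ψ(ℓ)` if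
`ℓ ∣ N₋`, `a_ℓ ≡ 0` if `ℓ ∣ N₀`, such that `𝓛_E ≡ (𝓔^ι_{φ,ψ})²·(𝓛_φ)² (mod pΛ^{ur})`, where
`𝓔_{φ,ψ} = ∏_{ℓ∣N₀N₋} 𝒫_w(φ) · ∏_{ℓ∣N₀N₊} 𝒫_w(ψ)`, and for each `ℓ ∣ N` we take the prime `w ∣ ℓ` with `w ∣ 𝔑`" (`N₀` the
square-full part of `N`; `𝒫_w(θ) = P_w(ℓ⁻¹γ_w)`, `ι : γ ↦ γ⁻¹`; §2 standing: `p ∤ 2N` good, `K` imaginary quadratic with (Heeg),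
(spl), (disc)). PROOF (L1062–L1116): "By [Kriz], our hypothesis on `E[p]` implies that there is a congruence `f ≡ G (mod p)` (2.12),
where `G` is a certain weight two Eisenstein series (denoted `E₂^{φ,φ⁻¹,(N)}` in loc.cit.)" — the ONLY use of «`φ ≠ 𝟙`» (LEAD g6
page-check `Cruxes/GoodLatticeBDPValue/Lines/halves_3aA_pagecheck_leadg6.md` §4) —, then `𝓛_G ≡ 𝓔^ι_{φ,ψ}·𝓛_φ` (2.14) from
Kriz's evaluation of `𝓛_G` and the interpolation property of `𝓛_φ`, and `𝓛_E ≡ (𝓛_G)² (mod pΛ^{ur})` (2.15) from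
`θ^m f(x_𝔞) ≡ θ^m G(x_𝔞)` for all `m ≥ 0`; "the combination of (2.14) and (2.15) now yields the theorem". THIS DECLARATION states
exactly what that proof proves: (eq:cong-mf) ⟹ the congruence, with (eq:cong-mf) entered through Kriz's DEFINITION — Def. 31:
`f = Σ a_n q^n ∈ S_k(Γ₀(N), ε_f)` has partial Eisenstein descent of type `(ψ₁,ψ₂,N₊,N₋,N₀)` mod `𝔪` (`N = N₊N₋N₀` pairwise coprime,
`N₊N₋` squarefree, `N₀` squarefull, `ψ₁ψ₂ = ε_f`) iff (1) `a_ℓ ≡ ψ₁(ℓ) + ψ₂(ℓ)ℓ^{k−1}` (`ℓ ∤ N`), (2) `a_ℓ ≡ ψ₁(ℓ)` (`ℓ ∣ N₊`),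
(3) `a_ℓ ≡ ψ₂(ℓ)ℓ^{k−1}` (`ℓ ∣ N₋`), (4) `a_ℓ ≡ 0` (`ℓ ∣ N₀`); FULL descent iff moreover (5)
`δ_{ψ₁=1}·(B_{1,ψ₂}B_{k,ψ₁}/k)·∏_{ℓ∣N₊}(1−ψ₁(ℓ)ℓ^{k−1})·∏_{ℓ∣N₋}(1−ψ₂(ℓ))·∏_{ℓ∣N₀}(1−ψ₁(ℓ)ℓ^{k−1})(1−ψ₂(ℓ)) ≡ 0 (mod 𝔪)`;
Rem. 32: "When `f` has full Eisenstein descent, this congruence [`θ^j f ≡ θ^j E_k^{ψ₁,ψ₂,(N)}`] holds for `j ≥ 0`"; Rem. 33 at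
`k = 2`, `ψ₁ = ψ₂ = 𝟙`: the constant is `(1/24)·∏(1−ℓ)`.
TRANSCRIPTION (binder for binder those of `thm212_exists_isKatzLFunction` / `KellerYin2024.thm222_anacong_goodLattice_OPEN` and of
the tree's CALLERS of [AN], `GoodLatticeBDPValueKatzUnitSuppliers.katzUnitAll_of_anacong`): `f = f_E` for `W/ℚ` globally minimal,
`k = 2`, `ε_f = 𝟙`, `M = ℚ_p`, `𝔪 = (p)`; "`E[p]^{ss} ≅ 𝔽_p(φ) ⊕ 𝔽_p(ψ)`" ↦ a rational line `Φ ≤ E[p]` with TEICHMÜLLER lifts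
`θsub = ψ̃` on `Φ`, `θquot = φ̃` on `E[p]/Φ` (`IsTeichmullerLiftOn/Quot`); "`p ∤ cond(φ)`" ↦ `θquot` unramified at `p`; `ψ₁ = φ̃`,
`ψ₂ = φ̃⁻¹` ("`ψ_1 = φ`, `ψ_2 = φ^{-1} = ψω^{-1}`", CGLS L1085); `a_ℓ = a_ℓ(W)` = Mathlib's `WeierstrassCurve.LFunction W ℓ`;
`ψ₁(ℓ)` ↦ ANY `a` with `θquot.HasFrobCharpolyAt u (X − a)` at the place `u ∋ ℓ` of `ℚ` (on `N₊N₋` with `θquot` unramified at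
`u`, as the printed congruence `a_ℓ ≡ φ(ℓ) ≢ 0` forces); the type ↦ finsets `Nplus ⊔ Nminus` = the multiplicative primes,
`Nzero` = the additive primes of `N_E`; (5) ↦ its `k = 2`, `ψ₁ = ψ₂ = 𝟙` instance with the constant `1/24` (only demanded when
`φ̃ = 𝟙`; for `φ̃ ≠ 𝟙`, `δ = 0`); "`≡ 0 (mod 𝔪)`" / "`(mod pΛ^{ur})`" ↦ norm `< 1` (`R₀ = W(𝔽̄_p)` has maximal ideal `pR₀`).
The CONCLUSION is read in the tree's frames — ANY BDP frame `(Ω_K, Ω_p, L)` of `f_E` (`IsBDPLFunction`, Castella's normalisation)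
and ANY Katz frame `(Ω_K', Ω_p', L_φ)` of `θ_K` = the Hecke character of `φ̃|_{Γ_K}` (`IsKatzLFunction`, `Cbar` ramified places) —
as: THERE EXIST places `w_ℓ ∋ ℓ` (`ℓ ∣ N_E`), local elements `Pq ℓ = 𝒫_{w_ℓ}(φ)^{±ι}`, `Ps ℓ = 𝒫_{w_ℓ}(ψ)^{±ι}`
(`1 − u·(1+T)^{±c_w}` with `u·ℓ ≡ θ(Frob_w)`, i.e. `u ≡ θ(ℓ)ℓ⁻¹`, `(1+T)^b` read through the structure map
`j : ℤ_p → R₀` as in the sibling frames; `= 1` where `θ|_K` ramifies, `P_w = 1`) and a UNIT `U ∈ R₀⟦T⟧ˣ`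
with `L ≡ U·((∏_{ℓ∈N₀∪N₋} Pq ℓ)(∏_{ℓ∈N₀∪N₊} Ps ℓ))²·L_φ²` coefficientwise mod `𝔪_{R₀}`. This is WEAKER than print: the unit
`U`, the free choice of the places and of the orientation `±` absorb (a) the two frames' independent period pairs, (b) the choice of
`𝔑`, (c) the normalisation of the tree's BDP frame against CGLS's `𝓛_E` and the dictionary `ξ = φ^c` of the Katz frame
(cell LIT-DOSSIER §36 (C′); frames rigidity `GoodLatticeAnacongFrames…` p742986/p743888) — each a unit of `Λ^{ur}` or the
involution `ι`, which the statement leaves free. CONSUMER (kernel, p757455):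
`GoodLatticeAnacongOfEisensteinCongruence.anacong_conclusion_of_eisensteinCongruence` turns this congruence + Hida 2010 Thm. I
(`Hida2010MuInvariant.thmI_mu_katzLFunction_eq_zero`) into the conclusion of the content stub 3a-A of crux 2. Named fact
(D-0014): nothing asserted; no step of Keller–Yin's preprint is used.
[cite: CastellaGrossiLeeSkinner2022, Thm. 2.2.1 (thm:kriz) and its PROOF, arXiv:2008.02571v2 TeX L1051–L1116 ((eq:cong-mf) (2.12), (eq:def-meas-G), (eq:kriz-prop37) (2.13), (eq:cor-37) (2.14), (eq:cor-meas) (2.15)); §2 standing hypotheses L940–942; Invent. Math. 227 (2022) §2.2]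
[cite: Kriz2016, Def. 31 with (5), Rem. 32 («When f has full Eisenstein descent, this congruence holds for j ≥ 0»), Rem. 33 (k = 2 display (1/24)∏(1−ℓ)) — Algebra Number Theory 10 (2016) 309–374, arXiv:1512.05032 pp. 20–21] -/
def proofThm221_congruence_of_fullEisensteinDescent : Prop :=
  ∀ (W : WeierstrassCurve ℚ) [W.IsElliptic] [W.IsGloballyMinimal] (p : ℕ) [Fact p.Prime],
    2 < p → Good W p →
    -- `E[p]^{ss} ≅ 𝔽_p(φ) ⊕ 𝔽_p(ψ)`: a rational line `Φ ≤ E[p]` with Teichmüller lifts `θsub = ψ̃` (on `Φ`) and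
    -- `θquot = φ̃` (on `E[p]/Φ`); "labeled so that `p ∤ cond(φ)`": `θquot` unramified at `p`
    ∀ (Φ : AddSubgroup (geomTorsion W (p : ℤ))), IsRationalLine W p Φ →
    ∀ (θsub θquot : FramedGaloisRep ℚ (padicCoeffIntegers (∅ : Set (PadicAlgCl p))) 1),
      IsTeichmullerLiftOn (∅ : Set (PadicAlgCl p)) (Φ.map (geomTorsion W (p : ℤ)).subtype) θsub →
      IsTeichmullerLiftOnQuot (∅ : Set (PadicAlgCl p)) (Φ.map (geomTorsion W (p : ℤ)).subtype)
        (geomTorsion W (p : ℤ)) θquot →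
      (∀ u : HeightOneSpectrum (𝓞 ℚ), ((p : ℕ) : 𝓞 ℚ) ∈ u.asIdeal → θquot.IsUnramifiedAt u) →
    -- (eq:cong-mf) `f ≡ E₂^{φ,φ⁻¹,(N)} (mod p)` ⟸ FULL Eisenstein descent of type `(φ̃, φ̃⁻¹, N₊, N₋, N₀)` mod `p`
    -- (Kriz 2016 Def. 31 with Rem. 32): the TYPE — `N₀` = the additive primes (squarefull part), `N₊ ⊔ N₋` = the
    -- multiplicative primes (squarefree part) of `N_E`
    ∀ (Nplus Nminus Nzero : Finset ℕ),
      Nplus ⊆ (W.conductorNorm ℤ).primeFactors → Nminus ⊆ (W.conductorNorm ℤ).primeFactors →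
      Nzero ⊆ (W.conductorNorm ℤ).primeFactors →
      (∀ (ℓ : ℕ) (hℓ : ℓ ∈ (W.conductorNorm ℤ).primeFactors),
        haveI : Fact ℓ.Prime := ⟨Nat.prime_of_mem_primeFactors hℓ⟩
        (ℓ ∈ Nzero ↔ ¬ W.HasMultiplicativeReductionAtPrime ℓ) ∧
        ((ℓ ∈ Nplus ∨ ℓ ∈ Nminus) ↔ W.HasMultiplicativeReductionAtPrime ℓ) ∧ ¬ (ℓ ∈ Nplus ∧ ℓ ∈ Nminus)) →
      -- (1) `a_ℓ ≡ φ̃(ℓ) + φ̃(ℓ)⁻¹ ℓ (mod p)` for `ℓ ∤ N`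
      (∀ (ℓ : ℕ) (u : HeightOneSpectrum (𝓞 ℚ)), ℓ.Prime → ((ℓ : ℕ) : 𝓞 ℚ) ∈ u.asIdeal →
        ¬ ℓ ∣ W.conductorNorm ℤ → ∀ a : padicCoeffIntegers (∅ : Set (PadicAlgCl p)),
        θquot.HasFrobCharpolyAt u (Polynomial.X - Polynomial.C a) →
        ‖((W.LFunction ℓ : ℤ) : PadicAlgCl p) - ((a : PadicAlgCl p) + (a : PadicAlgCl p)⁻¹ * (ℓ : PadicAlgCl p))‖ < 1) →
      -- (2) `a_ℓ ≡ φ̃(ℓ)` for `ℓ ∣ N₊`;  (3) `a_ℓ ≡ φ̃(ℓ)⁻¹ ℓ` for `ℓ ∣ N₋`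
      (∀ ℓ ∈ Nplus, ∀ u : HeightOneSpectrum (𝓞 ℚ), ((ℓ : ℕ) : 𝓞 ℚ) ∈ u.asIdeal → θquot.IsUnramifiedAt u ∧
        ∀ a : padicCoeffIntegers (∅ : Set (PadicAlgCl p)), θquot.HasFrobCharpolyAt u (Polynomial.X - Polynomial.C a) →
        ‖((W.LFunction ℓ : ℤ) : PadicAlgCl p) - (a : PadicAlgCl p)‖ < 1) →
      (∀ ℓ ∈ Nminus, ∀ u : HeightOneSpectrum (𝓞 ℚ), ((ℓ : ℕ) : 𝓞 ℚ) ∈ u.asIdeal → θquot.IsUnramifiedAt u ∧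
        ∀ a : padicCoeffIntegers (∅ : Set (PadicAlgCl p)), θquot.HasFrobCharpolyAt u (Polynomial.X - Polynomial.C a) →
        ‖((W.LFunction ℓ : ℤ) : PadicAlgCl p) - (a : PadicAlgCl p)⁻¹ * (ℓ : PadicAlgCl p)‖ < 1) →
      -- (4) `a_ℓ ≡ 0` for `ℓ ∣ N₀`
      (∀ ℓ ∈ Nzero, ‖((W.LFunction ℓ : ℤ) : PadicAlgCl p)‖ < 1) →
      -- (5) (k = 2, ε_f = 𝟙; only when `φ̃ = 𝟙`, Rem. 33): `(1/24)·∏_{ℓ∣N₊}(1−ℓ)·∏_{ℓ∣N₋}(1−1)·∏_{ℓ∣N₀}(1−ℓ)(1−1) ≡ 0 (mod p)`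
      ((∀ σ : absoluteGaloisGroup ℚ, θquot σ = 1) →
        ‖(((1 : ℚ) / 24 * ((∏ ℓ ∈ Nplus, (1 - (ℓ : ℚ))) * (∏ _ℓ ∈ Nminus, ((1 : ℚ) - 1)) *
            (∏ ℓ ∈ Nzero, (1 - (ℓ : ℚ)) * ((1 : ℚ) - 1))) : ℚ) : ℚ_[p])‖ < 1) →
    -- CGLS §2 standing hypotheses on `K` and the frames (verbatim the binders of `thm212_…` / `thm222_…`)
    ∀ (K : Type) [Field K] [NumberField K], IsImaginaryQuadratic K →
      SatisfiesHeegnerHypothesis (W.conductorNorm ℤ) K → SatisfiesHeegnerHypothesis p K →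
      Odd (NumberField.discr K) → NumberField.discr K ≠ -3 →
    ∀ (ι : K →+* ℚ_[p]) (v vbar : HeightOneSpectrum (𝓞 K)),
      (∀ x : 𝓞 K, x ∈ v.asIdeal ↔ ‖ι (x : K)‖ < 1) →
      ((p : ℕ) : 𝓞 K) ∈ vbar.asIdeal → vbar ≠ v →
    ∀ (κ : ZpExtension K p), κ.IsAnticyclotomic →
    ∀ (γ : absoluteGaloisGroup K) [Fact (κ.IsTopGenerator γ)],
    ∀ (N : ℕ) [NeZero N] (Dt : ModularParametrizationData W N),
    ∀ (ι' : PadicAlgCl p ≃+* ℂ),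
      (∀ (w : InfinitePlace K) (k : 𝓞 K), k ∈ v.asIdeal ↔ ‖ι'.symm (w.embedding (k : K))‖ < 1) →
    ∀ (ΩK : ℂ) (Ωp : (unrIntegers p)ˣ) (L : UnrSeries p), ΩK ≠ 0 →
      IsBDPLFunction ι' v κ γ Dt.f ΩK ((Ωp : unrIntegers p) : ℂ_[p]) L →
    ∀ (θK : HeckeCharacter K), IsHeckeCharOf ι' (θquot.restrictField K) θK →
    ∀ (Cbar : Finset (HeightOneSpectrum (𝓞 K))), (∀ u ∈ Cbar, ¬ θK.IsUnramifiedAt u) →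
    ∀ (ΩK' : ℂ) (Ωp' : (unrIntegers p)ˣ) (Lφ : UnrSeries p), ΩK' ≠ 0 →
      IsKatzLFunction ι' v vbar Cbar κ γ θK ΩK' ((Ωp' : unrIntegers p) : ℂ_[p]) Lφ →
    -- the structure map `j : ℤ_p → R₀` (`j(x) = x` in `ℂ_p`), through which `(1+T)^b`, `b ∈ ℤ_p`, is read in `R₀⟦T⟧`
    ∀ (j : ℤ_[p] →+* unrIntegers p), (∀ x : ℤ_[p], ((j x : unrIntegers p) : ℂ_[p]) = ((x : ℚ_[p]) : ℂ_[p])) →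
    -- CONCLUSION `𝓛_E ≡ (𝓔^ι_{φ,ψ})²·𝓛_φ² (mod pΛ^{ur})`, read in the frames up to a unit of `Λ^{ur} = R₀⟦T⟧`
    ∃ (wl : ℕ → HeightOneSpectrum (𝓞 K)) (Pq Ps : ℕ → UnrSeries p) (U : UnrSeries p), IsUnit U ∧
      (∀ ℓ ∈ (W.conductorNorm ℤ).primeFactors, ((ℓ : ℕ) : 𝓞 K) ∈ (wl ℓ).asIdeal) ∧
      (∀ ℓ ∈ (W.conductorNorm ℤ).primeFactors,
        (¬ (θquot.restrictField K).IsUnramifiedAt (wl ℓ) → Pq ℓ = 1) ∧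
        ((θquot.restrictField K).IsUnramifiedAt (wl ℓ) →
          ∃ (a : padicCoeffIntegers (∅ : Set (PadicAlgCl p))) (u : unrIntegers p) (b : ℤ_[p]),
            (θquot.restrictField K).HasFrobCharpolyAt (wl ℓ) (Polynomial.X - Polynomial.C a) ∧
            ‖(u : ℂ_[p]) * (ℓ : ℂ_[p]) - ((a : PadicAlgCl p) : ℂ_[p])‖ < 1 ∧
            (b = κ.frobExponentAt (wl ℓ) ∨ b = -κ.frobExponentAt (wl ℓ)) ∧
            Pq ℓ = 1 - C u * (binomialSeries ℤ_[p] b).map j)) ∧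
      (∀ ℓ ∈ (W.conductorNorm ℤ).primeFactors,
        (¬ (θsub.restrictField K).IsUnramifiedAt (wl ℓ) → Ps ℓ = 1) ∧
        ((θsub.restrictField K).IsUnramifiedAt (wl ℓ) →
          ∃ (a : padicCoeffIntegers (∅ : Set (PadicAlgCl p))) (u : unrIntegers p) (b : ℤ_[p]),
            (θsub.restrictField K).HasFrobCharpolyAt (wl ℓ) (Polynomial.X - Polynomial.C a) ∧
            ‖(u : ℂ_[p]) * (ℓ : ℂ_[p]) - ((a : PadicAlgCl p) : ℂ_[p])‖ < 1 ∧
            (b = κ.frobExponentAt (wl ℓ) ∨ b = -κ.frobExponentAt (wl ℓ)) ∧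
            Ps ℓ = 1 - C u * (binomialSeries ℤ_[p] b).map j)) ∧
      ∀ i : ℕ, ‖((coeff i L : unrIntegers p) : ℂ_[p]) -
        ((coeff i (U * ((∏ ℓ ∈ Nzero ∪ Nminus, Pq ℓ) * (∏ ℓ ∈ Nzero ∪ Nplus, Ps ℓ)) ^ 2 * Lφ ^ 2) :
          unrIntegers p) : ℂ_[p])‖ < 1

end Literature.NumberTheory.EllipticCurves.CastellaGrossiLeeSkinner2022

end
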